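import Literature.Computability.Complexity.PSpaceClosure
import Literature.Computability.Complexity.CountingGapPProofs
import Literature.Computability.Complexity.SharpPClosure
import Literature.Computability.Complexity.PlumbingBricks
import Literature.Computability.Complexity.CountingHierarchyInter
import Literature.Computability.Complexity.StockmeyerMachines
import HarnessLib

/-!
# Gap thresholds in `PSPACE`: `{u | 2^{p(|x|)} < 2·(#₁(u) - #₂(u))}` for `PSPACE` witness relations

Topic `Literature/Computability/Complexity` (space-bounded classes; companion of
`PSpaceClosure.lean` and of the `#P`/`GapP` toolkit `CountingGapPProofs.lean`,
`SharpPClosure.lean`). Fenner–Fortnow–Kurtz–Li, *An oracle builder's toolkit*, Inform. and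
Comput. 182 (2003), remark after Lemma 6.17 (p. 33): "it is easy to see that `F_j ∈ FPSPACE` for
`C^A = AWPP^A`" — the certificate tests of the Standard Algorithm compare a `GapP`-style gap
`#₁ - #₂` of two polynomial-space computable witness relations against the threshold
`2^{p(n)}/2`, and such a comparison is again a polynomial-space predicate (count the witnesses one
after the other reusing space; Gill's `PP ⊆ PSPACE`, Prop. 5.2, as for the tree's
`pMajority_PSPACE_subset_PSPACE`).

This file proves that closure property in the tree's models, by the padding-and-branching
arithmetic of Fenner–Fortnow–Kurtz 1994, Prop. 4.2 (the tree's `PPGapP.mem_PP_of_gapP`,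
`CountingGapPProofs.lean`), run inside `PSPACE` with the closure toolkit of `PSpaceClosure.lean`:

* `PSpaceGap.exists_sumRel` — the branching relation of two `PSPACE` relations ("branch on one
  coin, then run one of two machines"; the `PSPACE` twin of `PPGapP.exists_sumRel`);
* `PSpaceGap.exists_padRel` — padding a `PSPACE` relation whose witness length `r(|x|)` is read
  off the FIRST COMPONENT `x` of the input `u = ⟨x, t⟩` (the shape of the certificate tests, whose
  inputs carry a table `t` next to `x`), with `PSpaceGap.countWitnesses_padRel` (counts unchanged);
* `PSpaceGap.dropHasTrue_mem_P`, `PSpaceGap.cnt_true_mem_drop` — the filler relations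
  "`1 ∈ rest⇂k`" and their counts `2ⁿ - 2ᵏ`;
* **`gapThreshold_mem_PSPACE`**: for `R₁, R₂ ∈ PSPACE`, polynomials `r₁, r₂, p` and a
  Karp-`PSPACE`-complete `B` (for the unions of `PSpaceClosure.lean`),
  `{u | 2^{p(|x|)} < 2·(#_{R₁}^{r₁(|x|)}(u) - #_{R₂}^{r₂(|x|)}(u))} ∈ PSPACE`, `x = (boolUnpair u).1`:
  over coins `b₁ b₂ b₃ · rest` of length `n + 3`, `n = (r₁ + r₂ + p)(|u|)`, the branches
  `00· ↦ R₁` (padded; `2#₁`), `01· ↦ ¬R₂` (`2·2^{m₂} - 2#₂`), `10· ↦ [1 ∈ rest⇂m₂]`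
  (`2ⁿ⁺¹ - 2^{m₂+1}`), `110 ↦ [1 ∈ rest⇂p]` (`2ⁿ - 2^p`), `111 ↦` accept (`2ⁿ`) add up to
  `2(#₁ - #₂) + 2ⁿ⁺² - 2^p`, a strict majority iff `2^p < 2(#₁ - #₂)`; then `C·PSPACE ⊆ PSPACE`.

All theorems proved; no definitions besides the transparent `PSpaceGap.padMap`,
`PSpaceGap.dropPart`, `PSpaceGap.dropK` string maps.

## References

* [FennerFortnowKurtzLi2003IC] Lemma 6.17 and the remark following it (p. 33).
* S. Fenner, L. Fortnow, S. Kurtz, *Gap-definable counting classes*, JCSS 48 (1994), Prop. 3.5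
  (proof), Prop. 4.2 [FennerFortnowKurtz1994].
* J. Gill, SIAM J. Comput. 6 (1977), Prop. 5.2 (`PP ⊆ PSPACE`) [Gill1977].
-/

noncomputable section

namespace Literature.Computability.Complexity

open _root_.Computability Polynomial TTClosure PPGapP PPSharpP
open scoped Notation

namespace PSpaceGap

/-! ### Branching on the first coin -/

/-- **The sum relation of two `PSPACE` relations**: `⟨x, 0y⟩ ∈ R ↔ ⟨x, y⟩ ∈ L₀` and
`⟨x, 1y⟩ ∈ R ↔ ⟨x, y⟩ ∈ L₁`, in `PSPACE` (tags in `P`, preimages under `dropSndFn 1`, a union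
through the complete `B`). The `PSPACE` twin of `PPGapP.exists_sumRel`.
[cite: FennerFortnowKurtz1994, Proposition 3.5 (proof)] -/
theorem exists_sumRel {B : Language Bool} (hB : IsComplete PSPACE B) {L₀ L₁ : Language Bool}
    (h₀ : L₀ ∈ PSPACE) (h₁ : L₁ ∈ PSPACE) :
    ∃ R ∈ PSPACE, (∀ x y : List Bool, boolPair x (false :: y) ∈ R ↔ boolPair x y ∈ L₀) ∧
      (∀ x y : List Bool, boolPair x (true :: y) ∈ R ↔ boolPair x y ∈ L₁) := by
  have hTag1P : ((sndP ∘ truncSndFn 1) ⁻¹' HasBit true : Language Bool) ∈ Classes.P :=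
    preimage_mem_P (HasBit_mem_P true) (comp_mem_FP sndP_mem_FP (truncSndFn_mem_FP 1))
  have hTag0P : ((sndP ∘ truncSndFn 1) ⁻¹' NoBit true : Language Bool) ∈ Classes.P :=
    preimage_mem_P (NoBit_mem_P true) (comp_mem_FP sndP_mem_FP (truncSndFn_mem_FP 1))
  refine ⟨(((sndP ∘ truncSndFn 1) ⁻¹' NoBit true : Language Bool) ⊓ (dropSndFn 1 ⁻¹' L₀)) ⊔
      (((sndP ∘ truncSndFn 1) ⁻¹' HasBit true : Language Bool) ⊓ (dropSndFn 1 ⁻¹' L₁)),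
    union_mem_PSPACE_of_complete hB
      (inter_P_mem_PSPACE hTag0P (preimage_mem_PSPACE h₀ (dropSndFn_mem_FP 1)))
      (inter_P_mem_PSPACE hTag1P (preimage_mem_PSPACE h₁ (dropSndFn_mem_FP 1))),
    fun x y => ?_, fun x y => ?_⟩
  · show ((sndP (truncSndFn 1 (boolPair x (false :: y))) ∈ NoBit true ∧
        dropSndFn 1 (boolPair x (false :: y)) ∈ L₀) ∨
      (sndP (truncSndFn 1 (boolPair x (false :: y))) ∈ HasBit true ∧
        dropSndFn 1 (boolPair x (false :: y)) ∈ L₁)) ↔ _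
    rw [truncSndFn_boolPair, dropSndFn_boolPair, eval_one, sndP_boolPair]
    have ht : true ∉ List.take 1 (false :: y) := by simp
    constructor
    · rintro (⟨-, h⟩ | ⟨h, -⟩)
      · exact h
      · exact absurd h ht
    · exact fun h => Or.inl ⟨ht, h⟩
  · show ((sndP (truncSndFn 1 (boolPair x (true :: y))) ∈ NoBit true ∧
        dropSndFn 1 (boolPair x (true :: y)) ∈ L₀) ∨
      (sndP (truncSndFn 1 (boolPair x (true :: y))) ∈ HasBit true ∧
        dropSndFn 1 (boolPair x (true :: y)) ∈ L₁)) ↔ _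
    rw [truncSndFn_boolPair, dropSndFn_boolPair, eval_one, sndP_boolPair]
    have ht : true ∈ List.take 1 (true :: y) := by simp
    constructor
    · rintro (⟨h, -⟩ | ⟨-, h⟩)
      · exact absurd ht h
      · exact h
    · exact fun h => Or.inr ⟨ht, h⟩

/-! ### Padding a relation whose witness length is read off the first input component -/

/-- `padMap r ⟨u, y'⟩ = ⟨u, y'↾r(|x|)⟩`, `x = (boolUnpair u).1`. [folklore] -/
def padMap (r : Polynomial ℕ) : List Bool → List Bool :=
  fanoutFn fstP (Plumb.takeFn ∘ fanoutFn (Plumb.polyFn r ∘ fstP ∘ fstP) sndP)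

/-- `dropPart r ⟨u, y'⟩ = y'⇂r(|x|)`, `x = (boolUnpair u).1`. [folklore] -/
def dropPart (r : Polynomial ℕ) : List Bool → List Bool :=
  Plumb.dropFn ∘ fanoutFn (Plumb.polyFn r ∘ fstP ∘ fstP) sndP

/-- `padMap r ∈ FP`. [folklore] -/
theorem padMap_mem_FP (r : Polynomial ℕ) : padMap r ∈ FP :=
  fanoutFn_mem_FP fstP_mem_FP (comp_mem_FP Plumb.takeFn_mem_FP
    (fanoutFn_mem_FP (comp_mem_FP (Plumb.polyFn_mem_FP r) (comp_mem_FP fstP_mem_FP fstP_mem_FP))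
      sndP_mem_FP))

/-- `dropPart r ∈ FP`. [folklore] -/
theorem dropPart_mem_FP (r : Polynomial ℕ) : dropPart r ∈ FP :=
  comp_mem_FP Plumb.dropFn_mem_FP
    (fanoutFn_mem_FP (comp_mem_FP (Plumb.polyFn_mem_FP r) (comp_mem_FP fstP_mem_FP fstP_mem_FP))
      sndP_mem_FP)

/-- Value of `padMap` on a pair. [folklore] -/
theorem padMap_boolPair (r : Polynomial ℕ) (u y' : List Bool) :
    padMap r (boolPair u y') = boolPair u (y'.take (r.eval (fstP u).length)) := by
  simp [padMap]

/-- Value of `dropPart` on a pair. [folklore] -/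
theorem dropPart_boolPair (r : Polynomial ℕ) (u y' : List Bool) :
    dropPart r (boolPair u y') = y'.drop (r.eval (fstP u).length) := by
  simp [dropPart]

/-- **Padded relation**: for `R ∈ PSPACE` and `r` there is `Rp ∈ PSPACE` with
`⟨u, y'⟩ ∈ Rp ↔ ⟨u, y'↾m⟩ ∈ R ∧ y'⇂m = 1^*`, `m = r(|x|)` read off the first component `x` of `u`.
[cite: AroraBarakCC2009, Def. 17.2 (padding witnesses)] -/
theorem exists_padRel (r : Polynomial ℕ) {R : Language Bool} (hR : R ∈ PSPACE) :
    ∃ Rp ∈ PSPACE, ∀ u y' : List Bool, boolPair u y' ∈ Rp ↔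
      boolPair u (y'.take (r.eval (fstP u).length)) ∈ R ∧
        y'.drop (r.eval (fstP u).length) =
          List.replicate (y'.length - r.eval (fstP u).length) true := by
  refine ⟨({w | dropPart r w = (onesFn ∘ dropPart r) w} : Language Bool) ⊓ (padMap r ⁻¹' R : Language Bool),
    inter_P_mem_PSPACE
      (setOf_apply_eq_apply_mem_P (dropPart_mem_FP r) (comp_mem_FP onesFn_mem_FP (dropPart_mem_FP r)))
      (preimage_mem_PSPACE hR (padMap_mem_FP r)), fun u y' => ?_⟩
  rw [Language.mem_inf, memL_preimage, padMap_boolPair, StockMachine.memL_setOf, Function.comp_apply,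
    dropPart_boolPair, onesFn_eq_replicate, List.length_drop]
  exact and_comm

/-- Padding does not change the count (`countWitnesses_of_padSpec`). [cite: AroraBarakCC2009, Def. 17.2] -/
theorem countWitnesses_padRel {r : Polynomial ℕ} {R Rp : Language Bool}
    (hspec : ∀ u y' : List Bool, boolPair u y' ∈ Rp ↔
      boolPair u (y'.take (r.eval (fstP u).length)) ∈ R ∧
        y'.drop (r.eval (fstP u).length) = List.replicate (y'.length - r.eval (fstP u).length) true)
    (u : List Bool) {m' : ℕ} (hm : r.eval (fstP u).length ≤ m') :
    countWitnesses Rp m' u = countWitnesses R (r.eval (fstP u).length) u :=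
  countWitnesses_of_padSpec R Rp u _ (hspec u) hm

/-! ### The filler relations `1 ∈ rest⇂k` -/

/-- `dropK k ⟨u, rest⟩ = rest⇂k(|x|)`, `x = (boolUnpair u).1` (the same map as `dropPart`, named for
its role). [folklore] -/
abbrev dropK (k : Polynomial ℕ) : List Bool → List Bool := dropPart k

/-- `{⟨u, rest⟩ | 1 ∈ rest⇂k(|x|)} ∈ P`. [folklore] -/
theorem dropHasTrue_mem_P (k : Polynomial ℕ) : (dropK k ⁻¹' HasBit true : Language Bool) ∈ Classes.P :=
  preimage_mem_P (HasBit_mem_P true) (dropPart_mem_FP k)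

/-- Membership in the filler relation. [folklore] -/
theorem boolPair_mem_dropHasTrue (k : Polynomial ℕ) (u rest : List Bool) :
    boolPair u rest ∈ (dropK k ⁻¹' HasBit true : Language Bool) ↔
      true ∈ rest.drop (k.eval (fstP u).length) := by
  show dropPart k (boolPair u rest) ∈ HasBit true ↔ _
  rw [dropPart_boolPair, mem_HasBit]

/-- **Counting the fillers**: `#{rest ∈ {0,1}ⁿ | 1 ∈ rest⇂k} = 2ⁿ - 2ᵏ` for `k ≤ n` (the strings
whose last `n - k` bits are not all `0`), additive form. [folklore] -/
theorem cnt_true_mem_drop : ∀ (k n : ℕ), k ≤ n → cnt n {y : List Bool | true ∈ y.drop k} + 2 ^ k = 2 ^ n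
  | 0, n, _ => by simpa using cnt_hasTrue n
  | k + 1, 0, h => absurd h (Nat.not_succ_le_zero k)
  | k + 1, n + 1, h => by
    have ih := cnt_true_mem_drop k n (Nat.le_of_succ_le_succ h)
    rw [cnt_succ]
    have h0 : cnt n {y : List Bool | false :: y ∈ {y : List Bool | true ∈ y.drop (k + 1)}} =
        cnt n {y | true ∈ y.drop k} := cnt_congr fun y _ => by simp
    have h1 : cnt n {y : List Bool | true :: y ∈ {y : List Bool | true ∈ y.drop (k + 1)}} =
        cnt n {y | true ∈ y.drop k} := cnt_congr fun y _ => by simp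
    rw [h0, h1, pow_succ, pow_succ]
    omega

/-! ### The threshold language -/

/-- **Gap thresholds are in `PSPACE`.** For `R₁, R₂ ∈ PSPACE`, polynomials `r₁, r₂, p` and a
Karp-`PSPACE`-complete `B`, the language of the `u` with `2^{p(|x|)} < 2·(#₁(u) - #₂(u))`,
`#ᵢ(u) = #{y ∈ {0,1}^{rᵢ(|x|)} | ⟨u, y⟩ ∈ Rᵢ}`, `x = (boolUnpair u).1`, is in `PSPACE`: a majority
vote over `n + 3` coins, `n = (r₁ + r₂ + p)(|u|)`, whose branches `00·` (`R₁`), `01·` (`¬R₂`),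
`10·` (`1 ∈ rest⇂r₂(|x|)`), `110` (`1 ∈ rest⇂p(|x|)`), `111` (accept) count
`2(#₁ - #₂) + 2ⁿ⁺² - 2^{p(|x|)}` accepted strings. [cite: FennerFortnowKurtz1994, Proposition 4.2 (proof)] [cite: FennerFortnowKurtzLi2003IC, Lemma 6.17 (remark, p. 33: F_j ∈ FPSPACE for AWPP)] -/
theorem gapThreshold_mem_PSPACE {B : Language Bool} (hB : IsComplete PSPACE B)
    {R₁ R₂ : Language Bool} (h₁ : R₁ ∈ PSPACE) (h₂ : R₂ ∈ PSPACE) (r₁ r₂ p : Polynomial ℕ) :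
    {u : List Bool | (2 : ℤ) ^ p.eval (fstP u).length <
      2 * ((countWitnesses R₁ (r₁.eval (fstP u).length) u : ℤ) -
        (countWitnesses R₂ (r₂.eval (fstP u).length) u : ℤ))} ∈ PSPACE := by
  -- the padded relations and the fillers
  obtain ⟨A, hA, hAspec⟩ := exists_padRel r₁ h₁
  obtain ⟨Bc, hBc, hBcspec⟩ := exists_padRel r₂ (compl_mem_PSPACE h₂)
  have hDm : (dropK r₂ ⁻¹' HasBit true : Language Bool) ∈ PSPACE := P_subset_PSPACE_holds (dropHasTrue_mem_P r₂)
  have hDp : (dropK p ⁻¹' HasBit true : Language Bool) ∈ PSPACE := P_subset_PSPACE_holds (dropHasTrue_mem_P p)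
  have hU : (⊤ : Language Bool) ∈ PSPACE := P_subset_PSPACE_holds top_mem_P
  -- the three branching layers
  obtain ⟨S₀₀, hS₀₀, hS₀₀0, hS₀₀1⟩ := exists_sumRel hB hA hA
  obtain ⟨S₀₁, hS₀₁, hS₀₁0, hS₀₁1⟩ := exists_sumRel hB hBc hBc
  obtain ⟨S₁₀, hS₁₀, hS₁₀0, hS₁₀1⟩ := exists_sumRel hB hDm hDm
  obtain ⟨S₁₁, hS₁₁, hS₁₁0, hS₁₁1⟩ := exists_sumRel hB hDp hU
  obtain ⟨T₀, hT₀, hT₀0, hT₀1⟩ := exists_sumRel hB hS₀₀ hS₀₁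
  obtain ⟨T₁, hT₁, hT₁0, hT₁1⟩ := exists_sumRel hB hS₁₀ hS₁₁
  obtain ⟨W, hW, hW0, hW1⟩ := exists_sumRel hB hT₀ hT₁
  -- the count
  refine pMajority_mem_PSPACE hW (r₁ + r₂ + p + 3) fun u => ?_
  have hxu : (fstP u).length ≤ u.length := by
    have := length_boolUnpair_parts_le u
    change (boolUnpair u).1.length ≤ u.length
    omega
  have hm₁ : r₁.eval (fstP u).length ≤ (r₁ + r₂ + p).eval u.length := by
    rw [eval_add, eval_add]
    have := TM2Iter.eval_mono r₁ hxu
    omega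
  have hm₂ : r₂.eval (fstP u).length ≤ (r₁ + r₂ + p).eval u.length := by
    rw [eval_add, eval_add]
    have := TM2Iter.eval_mono r₂ hxu
    omega
  have hp : p.eval (fstP u).length ≤ (r₁ + r₂ + p).eval u.length := by
    rw [eval_add, eval_add]
    have := TM2Iter.eval_mono p hxu
    omega
  -- counts of the leaves
  have cA : countWitnesses A ((r₁ + r₂ + p).eval u.length) u =
      countWitnesses R₁ (r₁.eval (fstP u).length) u :=
    countWitnesses_padRel hAspec u hm₁
  have cBc : countWitnesses Bc ((r₁ + r₂ + p).eval u.length) u +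
      countWitnesses R₂ (r₂.eval (fstP u).length) u = 2 ^ r₂.eval (fstP u).length := by
    rw [countWitnesses_padRel hBcspec u hm₂, add_comm]
    exact countWitnesses_add_compl R₂ _ u
  have cD : ∀ k : Polynomial ℕ, k.eval (fstP u).length ≤ (r₁ + r₂ + p).eval u.length →
      countWitnesses (dropK k ⁻¹' HasBit true : Language Bool) ((r₁ + r₂ + p).eval u.length) u +
        2 ^ k.eval (fstP u).length = 2 ^ (r₁ + r₂ + p).eval u.length := by
    intro k hk
    have h := cnt_true_mem_drop (k.eval (fstP u).length) ((r₁ + r₂ + p).eval u.length) hk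
    have hc : countWitnesses (dropK k ⁻¹' HasBit true : Language Bool) ((r₁ + r₂ + p).eval u.length) u =
        cnt ((r₁ + r₂ + p).eval u.length) {y : List Bool | true ∈ y.drop (k.eval (fstP u).length)} := by
      rw [countWitnesses_eq_cnt]
      exact cnt_congr fun y _ => boolPair_mem_dropHasTrue k u y
    rw [hc]
    exact h
  have cU : countWitnesses (⊤ : Language Bool) ((r₁ + r₂ + p).eval u.length) u =
      2 ^ (r₁ + r₂ + p).eval u.length := by
    rw [countWitnesses_eq_cnt]
    exact cnt_eq_two_pow_of_forall fun _ _ => trivial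
  -- the total
  have htot : countWitnesses W ((r₁ + r₂ + p).eval u.length + 3) u +
        2 * countWitnesses R₂ (r₂.eval (fstP u).length) u + 2 ^ p.eval (fstP u).length =
      2 * countWitnesses R₁ (r₁.eval (fstP u).length) u + 2 ^ ((r₁ + r₂ + p).eval u.length + 2) := by
    rw [show (r₁ + r₂ + p).eval u.length + 3 = (r₁ + r₂ + p).eval u.length + 1 + 1 + 1 from rfl,
      countWitnesses_sumRel hW0 hW1, countWitnesses_sumRel hT₀0 hT₀1,
      countWitnesses_sumRel hT₁0 hT₁1, countWitnesses_sumRel hS₀₀0 hS₀₀1,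
      countWitnesses_sumRel hS₀₁0 hS₀₁1, countWitnesses_sumRel hS₁₀0 hS₁₀1,
      countWitnesses_sumRel hS₁₁0 hS₁₁1, cA, cU]
    have hDm' := cD r₂ hm₂
    have hDp' := cD p hp
    have h2 : 2 ^ r₂.eval (fstP u).length ≤ 2 ^ (r₁ + r₂ + p).eval u.length :=
      Nat.pow_le_pow_right (by norm_num) hm₂
    have h3 : 2 ^ p.eval (fstP u).length ≤ 2 ^ (r₁ + r₂ + p).eval u.length :=
      Nat.pow_le_pow_right (by norm_num) hp
    rw [pow_succ, pow_succ]
    omega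
  -- majority iff the threshold
  change (2 : ℤ) ^ p.eval (fstP u).length < 2 * ((countWitnesses R₁ (r₁.eval (fstP u).length) u : ℤ) -
      (countWitnesses R₂ (r₂.eval (fstP u).length) u : ℤ)) ↔
    1 / 2 < uniformProb ((r₁ + r₂ + p + 3).eval u.length) {y : List Bool | boolPair u y ∈ W}
  rw [half_lt_uniformProb_iff, ← countWitnesses_eq_cnt, eval_add,
    show (3 : Polynomial ℕ).eval u.length = 3 by simp]
  have hpow : (2 : ℤ) ^ ((r₁ + r₂ + p).eval u.length + 3) = 2 * 2 ^ ((r₁ + r₂ + p).eval u.length + 2) := by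
    ring
  zify at htot
  constructor
  · intro h
    have h' : (2 : ℤ) ^ ((r₁ + r₂ + p).eval u.length + 3) <
        2 * (countWitnesses W ((r₁ + r₂ + p).eval u.length + 3) u : ℤ) := by
      nlinarith [htot, h, hpow]
    exact_mod_cast h'
  · intro h
    have h' : (2 : ℤ) ^ ((r₁ + r₂ + p).eval u.length + 3) <
        2 * (countWitnesses W ((r₁ + r₂ + p).eval u.length + 3) u : ℤ) := by
      exact_mod_cast h
    nlinarith [htot, h', hpow]

end PSpaceGap

export PSpaceGap (gapThreshold_mem_PSPACE)

end Literature.Computability.Complexity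

end
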